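import Literature.NumberTheory.Automorphic.Sweep1BaseChangeGLOne
import Literature.NumberTheory.Automorphic.ArthurClozelBaseChangeAssembly
import Literature.NumberTheory.Automorphic.StrongMultiplicityOneGLOneCorollaries
import HarnessLib

/-!
# Arthur–Clozel, Ch. 3, Thm. 4.2 (a) in rank one, with uniqueness and `σ`-stability (assembly)

Topic `NumberTheory/Automorphic`; proof file (theorems only: no definition, no named fact, no
instance) under the named facts `exists_cuspidal_baseChange_of_not_dvd` (`Sweep1`, **lang.S23**),
`ArthurClozel1989_exists_cuspidal_weakLift_or_dvd` (`Sweep1Proofs`) and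
`ArthurClozel1989_weakLifting_cuspidal` (`ArthurClozelBaseChange`; Arthur–Clozel (1989), Ch. 3,
Thm. 4.2 (a)).

`Sweep1BaseChangeGLOne` proves lang.S23 outright in rank `n = 1` (`GL(1)` base change
`χ ↦ χ ∘ N_{E/F}`). Combining it with the tree's proved rank-one strong multiplicity one
(`strong_multiplicity_one_gl_of_le_one`, `StrongMultiplicityOneGLOneCorollaries`), the uniqueness of
automorphic measures (`isAutomorphicMeasure_unique_smul_holds`) and the proved assemblies of
`Sweep1BaseChangeProofs`, `AutomorphicGaloisConjBaseChange` and `ArthurClozelBaseChangeAssembly`,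
this file records **Thm. 4.2 (a) in rank one in full, unconditionally**:

* `arthurClozel1989_weakLifting_cuspidal_one` — **`ArthurClozel1989_weakLifting_cuspidal 1 F E`**:
  existence, `σ`-stability and uniqueness of the cuspidal weak base-change lift of every cuspidal
  `π` on `GL_1(𝔸_F)` with `π ≇ π ⊗ η`, for `E/F` cyclic of prime degree with class-field character
  `η` (Thm. 4.2 (a) as rendered in the tree, `n = 1`): the existence-and-cuspidality clause of
  (a) holds in rank one for every cuspidal `π` whatever `π ⊗ η` is (`ℓ ∤ 1`,
  `arthurClozel1989_exists_cuspidal_weakLift_or_dvd_one`), and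
  `arthurClozel1989_weakLifting_cuspidal_of_exists` (`ArthurClozelBaseChangeAssembly`) adds
  uniqueness and `σ`-stability from rank-one strong multiplicity one over `E`;
* `existsUnique_cuspidal_weakLift_one`, `existsUnique_isGalStable_cuspidal_weakLift_one` — the
  `η`-free forms: for `E/F` Galois of prime degree every cuspidal `π` on `GL_1(𝔸_F)` has a unique
  cuspidal weak lift in `L²_cusp(GL_1(𝔸_E) ⧸ ℝ_{>0} Eˣ, ν)`, and it is `Gal(E/F)`-stable.

For `n ≥ 2` these facts remain undischarged (comparison of trace formulae).

## References

* J. Arthur, L. Clozel, *Simple algebras, base change, and the advanced theory of the trace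
  formula*, Ann. of Math. Stud. 120 (1989), Ch. 3, §1 Def. 1.1, Thm. 4.2 (a). [ArthurClozelAMS120]
-/

noncomputable section

open NumberField IsDedekindDomain MeasureTheory Filter

namespace Literature.NumberTheory.Automorphic

open AdelicGroupData

variable {F E : Type} [Field F] [NumberField F] [Field E] [NumberField E] [Algebra F E]

/-- **Arthur–Clozel, Ch. 3, Thm. 4.2 (a) in rank one (existence, `σ`-stability, uniqueness),
unconditionally**: the named fact `ArthurClozel1989_weakLifting_cuspidal 1 F E`, assembled by
`arthurClozel1989_weakLifting_cuspidal_of_exists` (`ArthurClozelBaseChangeAssembly`: Thm. 4.2 (a)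
from its existence-and-cuspidality clause and strong multiplicity one over `E`) from the rank-one
existence clause — every cuspidal `π` on `GL_1(𝔸_F)` has a cuspidal weak lift, whatever `π ⊗ η`
is, by `arthurClozel1989_exists_cuspidal_weakLift_or_dvd_one` and `ℓ ∤ 1` — and rank-one strong
multiplicity one over `E` (`strong_multiplicity_one_gl_of_le_one`).
[cite: ArthurClozelAMS120, Ch. 3, Thm. 4.2 (a)] -/
theorem arthurClozel1989_weakLifting_cuspidal_one : ArthurClozel1989_weakLifting_cuspidal 1 F E :=
  arthurClozel1989_weakLifting_cuspidal_of_exists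
    (by
      intro _ _ hℓ _ _ μ _ _ P _
      exact (arthurClozel1989_exists_cuspidal_weakLift_or_dvd_one hℓ μ P).resolve_right
        fun h => hℓ.ne_one (Nat.dvd_one.1 h))
    fun _ _ => strong_multiplicity_one_gl_of_le_one le_rfl

/-- **Existence and uniqueness of the cuspidal weak base-change lift in rank one** (`η`-free):
for `E/F` Galois of prime degree and `π` cuspidal on `GL_1(𝔸_F)`, some
`L²_cusp(GL_1(𝔸_E) ⧸ ℝ_{>0} Eˣ, ν)` contains exactly one cuspidal weak lift of `π`
(`existsUnique_cuspidal_weakLift_of_not_dvd'` with its two inputs now theorems in rank one).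
[cite: ArthurClozelAMS120, Ch. 3, Thm. 4.2 (a)] -/
theorem existsUnique_cuspidal_weakLift_one [IsGalois F E] (hℓ : (Module.finrank F E).Prime)
    (μ : Measure (gl 1 F).automorphicQuotient) [(gl 1 F).IsAutomorphicMeasure μ]
    (P : CuspidalAutomorphicRepGL 1 F μ) :
    ∃ (ν : Measure (gl 1 E).automorphicQuotient) (_ : (gl 1 E).IsAutomorphicMeasure ν),
      ∃! Q : CuspidalAutomorphicRepGL 1 E ν, IsWeakBaseChangeLift P.1 Q.1 :=
  existsUnique_cuspidal_weakLift_of_not_dvd' arthurClozel1989_exists_cuspidal_weakLift_or_dvd_one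
    (fun _ _ => strong_multiplicity_one_gl_of_le_one le_rfl) hℓ
    (fun h => hℓ.ne_one (Nat.dvd_one.1 h)) μ P

/-- **The rank-one lift is unique and `Gal(E/F)`-stable** (`η`-free form of Thm. 4.2 (a) for
`n = 1`): `existsUnique_isGalStable_cuspidal_weakLift_of_not_dvd` with its three inputs —
existence (rank one, this cluster), strong multiplicity one (rank one) and uniqueness of
automorphic measures (`isAutomorphicMeasure_unique_smul_holds`) — all theorems.
[cite: ArthurClozelAMS120, Ch. 3, Thm. 4.2 (a)] -/
theorem existsUnique_isGalStable_cuspidal_weakLift_one [IsGalois F E]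
    (hℓ : (Module.finrank F E).Prime)
    (μ : Measure (gl 1 F).automorphicQuotient) [(gl 1 F).IsAutomorphicMeasure μ]
    (P : CuspidalAutomorphicRepGL 1 F μ) :
    ∃ (ν : Measure (gl 1 E).automorphicQuotient) (_ : (gl 1 E).IsAutomorphicMeasure ν)
      (hν : IsGalInvariant F ν),
      ∃! Q : CuspidalAutomorphicRepGL 1 E ν,
        IsWeakBaseChangeLift P.1 Q.1 ∧ ∀ σ : E ≃ₐ[F] E, Q.IsGalStable F hν σ :=
  existsUnique_isGalStable_cuspidal_weakLift_of_not_dvd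
    arthurClozel1989_exists_cuspidal_weakLift_or_dvd_one
    (fun _ _ => strong_multiplicity_one_gl_of_le_one le_rfl)
    (isAutomorphicMeasure_unique_smul_holds 1 E) hℓ (fun h => hℓ.ne_one (Nat.dvd_one.1 h)) μ P

end Literature.NumberTheory.Automorphic
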